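import Summits.ResolutionOfSingularities.ResolutionOfSingularities.Theorems.PurelyInseparableDim4NearDim
import Literature.AlgebraicGeometry.Resolution.WeightedCentreHeavyTaylor
import Mathlib.Algebra.MvPolynomial.Funext
import Mathlib.RingTheory.MvPolynomial.Homogeneous
import Mathlib.RingTheory.MvPolynomial.EulerIdentity
import HarnessLib

/-!
# [OURS · res-dim4-pi PR-3c] The CONVERSE of PR-3 for the point blow-up: over an infinite field, a
  (cleaned) state with `q ≤ ord₀ F < 2q` has a NON-equimultiple point in EVERY chart — so
  `near_dim = n − 1 ⟺ ord₀ F ≥ 2q` (the LOCUS flag as an iff, `e = 1`)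

Cell `res-dim4-pi` (D-0157 DOOR 2), seat `res-dim4-p-3`, sequel of `PurelyInseparableDim4NearDim.lean`
(`isEquimultiplePoint_univ_of_two_mul_le_ordZero`: `2q ≤ ord₀ F ⇒` every point of every chart near).
Model: the tree's `CentreBlowup.*` with the POINT centre `S = univ` (the frame's `Step0`), over a field.

## What is proved (`K` a field; `σ` finite; `s : CState σ K`, `F = s.F`; chart `j`; `b_j = 0`)

* §1 `eval_smul_of_isHomogeneous`, `eq_zero_of_isHomogeneous_of_forall_eval_update`: a homogeneous
  form vanishing at every point with `x_j = 1` of an INFINITE field is `0`.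
* §2 **the layer identity** `coeff_add_single_pointTransform_univ`: if every monomial of `F` has degree
  `≥ m ≥ q`, then for every `γ` with `γ_j = 0`
  `coeff (γ + (m − q)·e_j) (pointTransform q univ j b s) = coeff γ (F_m(U + b̂))`,
  `F_m = homogeneousComponent m F`, `b̂ = b` with `b̂_j = 1` — the `x_j^{m−q}`-layer of the transform at
  `b` is the translate of the DEHOMOGENISED initial form (adapted from the tree's private layer lemma of
  `PointBlowupNearRidge`, there for `m = q`); `coeff_zero_translate_eq_eval`,
  `coeff_single_translate_eq_eval_pderiv` (Taylor to first order).
* §3 **`exists_not_isEquimultiplePoint_of_lt_two_mul`** (`q < ord₀ F < 2q`, `K` infinite, NO cleanliness):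
  every chart has a non-near point — else `F_m(b̂) = 0` for all `b̂`, forcing `F_m = 0`.
* §4 **`exists_not_isEquimultiplePoint_of_ordZero_eq`** (`ord₀ F = p` prime `= char K`, `K` infinite,
  `F` CLEAN: `deletePthPowers p F = F`): every chart has a non-near point — else `∂ᵢF_p(b̂) = 0` for all
  `i ≠ j` and all `b̂`, so `∂ᵢF_p = 0` (`i ≠ j`), every monomial of `F_p` has all exponents off `j`
  divisible by `p`, hence (degree `p`) is a `p`-th power monomial — deleted by cleaning, contradiction.
* §5 **`two_mul_le_ordZero_of_forall_isEquimultiplePoint`** and the iff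
  **`forall_isEquimultiplePoint_iff_two_mul_le_ordZero`**: for a clean state with `p ≤ ord₀ F` over an
  infinite field of characteristic `p`, «every point of the chart-`j` exceptional hyperplane is near»
  `⟺ 2p ≤ ord₀ F` — the engines' `near_dim = n − 1` / LOCUS flag (geometric points) is EXACTLY the
  small-order-gap condition of PR-3, in every chart.

[OURS · counted 0 · elementary; AI kernel work, weaker than expert review.]  Geometric (infinite-field)
statement; over `𝔽_p`-points only the engines' probe can see all points near for other reasons.  Nothing
here is a statement about resolution of singularities; resolution in dimension `≥ 4` / characteristic
`p > 0` is NOT proved by anything in this file.  Host item (DR-157-C): `stmt-ResolutionOfSingularities-16155`,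
helper.
-/

noncomputable section

set_option linter.dupNamespace false -- mandated namespace of this single-conjunct summit

open MvPolynomial Finset
open scoped BigOperators

namespace Summit.ResolutionOfSingularities.ResolutionOfSingularities.Theorems.PIDim4.NearDim

open Literature.AlgebraicGeometry.Resolution
open Literature.AlgebraicGeometry.Resolution.CentreBlowup
open Literature.AlgebraicGeometry.Resolution.Hauser2010

variable {σ : Type*} {K : Type*} [Field K] [Fintype σ] [DecidableEq σ]

/-! ## §1 Homogeneous forms vanishing on the hyperplane `x_j = 1` -/

omit [DecidableEq σ] in
/-- `Φ(c·x) = c^n Φ(x)` for `Φ` homogeneous of degree `n`. OURS (bookkeeping). [folklore] -/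
theorem eval_smul_of_isHomogeneous {Φ : MvPolynomial σ K} {n : ℕ} (hΦ : Φ.IsHomogeneous n) (c : K)
    (x : σ → K) : eval (c • x) Φ = c ^ n * eval x Φ := by
  rw [MvPolynomial.eval_eq', MvPolynomial.eval_eq', Finset.mul_sum]
  refine Finset.sum_congr rfl fun d hd => ?_
  have hdeg : ∑ i, d i = n := by
    have := hΦ (mem_support_iff.mp hd)
    rw [← this, Finsupp.weight_apply, Finsupp.sum_fintype _ _ (fun _ => by simp)]
    simp
  have : (∏ i, (c • x) i ^ d i) = c ^ n * ∏ i, x i ^ d i := by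
    simp_rw [Pi.smul_apply, smul_eq_mul, mul_pow, Finset.prod_mul_distrib,
      Finset.prod_pow_eq_pow_sum, hdeg]
  rw [this]
  ring

/-- **A homogeneous form vanishing at every point with `x_j = 1` of an infinite field is zero**
(scale: it vanishes wherever `x_j ≠ 0`, so `Φ·X_j` vanishes everywhere; Mathlib `MvPolynomial.funext`).
OURS (elementary). [folklore] -/
theorem eq_zero_of_isHomogeneous_of_forall_eval_update [Infinite K] {Φ : MvPolynomial σ K} {n : ℕ}
    (hΦ : Φ.IsHomogeneous n) (j : σ) (h : ∀ b : σ → K, eval (Function.update b j 1) Φ = 0) :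
    Φ = 0 := by
  classical
  have hX : Φ * X j = 0 := by
    apply MvPolynomial.funext
    intro w
    rw [map_mul, eval_X, map_zero]
    by_cases hw : w j = 0
    · rw [hw, mul_zero]
    · have hscale : w = w j • Function.update ((w j)⁻¹ • w) j 1 := by
        funext i
        by_cases hij : i = j
        · subst hij; simp
        · simp [Function.update_of_ne hij, hw]
      rw [hscale, eval_smul_of_isHomogeneous hΦ, h, mul_zero, zero_mul]
  rcases mul_eq_zero.mp hX with h0 | h0
  · exact h0
  · exact absurd h0 (X_ne_zero j)

/-! ## §2 The layer identity for the point blow-up -/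

omit [Fintype σ] [DecidableEq σ] in
/-- The constant term of `Φ(U + v)` is `Φ(v)`. OURS (bookkeeping). [cite: Hauser2010, §F (chart expressions of a point blowup)] -/
theorem coeff_zero_translate_eq_eval (v : σ → K) (Φ : MvPolynomial σ K) :
    coeff 0 (PointBlowup.translate v Φ) = eval v Φ := by
  have h : constantCoeff.comp
      (aeval fun i => (X i + C (v i) : MvPolynomial σ K)).toRingHom = eval v := by
    refine MvPolynomial.ringHom_ext (fun r => ?_) (fun i => ?_)
    · simp
    · simp
  exact DFunLike.congr_fun h Φ

omit [Fintype σ] in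
/-- **Taylor to first order**: the coefficient of `U_i` in `Φ(U + v)` is `(∂ᵢΦ)(v)`. OURS (bookkeeping;
tree `PointBlowup.pderiv_translate`, `WeightedBlowup.coeff_pderiv_eq`). [cite: Hauser2010, §F] -/
theorem coeff_single_translate_eq_eval_pderiv (v : σ → K) (i : σ) (Φ : MvPolynomial σ K) :
    coeff (Finsupp.single i 1) (PointBlowup.translate v Φ) = eval v (pderiv i Φ) := by
  have h1 := WeightedBlowup.coeff_pderiv_eq i (PointBlowup.translate v Φ) 0
  rw [zero_add, Finsupp.coe_zero, Pi.zero_apply, zero_add, Nat.cast_one, one_mul] at h1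
  rw [← h1, PointBlowup.pderiv_translate, coeff_zero_translate_eq_eval]

/-- **The layer identity.** If every monomial of `F` has degree `≥ m` and `q ≤ m`, then at a point `b`
with `b_j = 0` of the chart `x_j` of the POINT blow-up, for every exponent `γ` with `γ_j = 0`:
`coeff (γ + (m−q)·e_j) (pointTransform q univ j b s) = coeff γ (F_m(U + b̂))`, `F_m` the degree-`m`
component, `b̂ = b` with `b̂_j := 1` (only the degree-`m` monomials reach `x_j`-exponent `m − q`; on them the
chart substitution followed by reading off `x_j^{m−q}` is dehomogenisation `x_j := 1` followed by the
translation). Adapted from the tree's layer lemma of `PointBlowupNearRidge` (`m = q` there). OURS.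
[cite: Hauser2010, §F (chart expressions of a point blowup)] -/
theorem coeff_add_single_pointTransform_univ {q m : ℕ} (hqm : q ≤ m) (j : σ) (b : σ → K)
    (hbj : b j = 0) (s : CState σ K) (hm : ∀ d ∈ s.F.support, m ≤ d.degree) (γ : σ →₀ ℕ)
    (hγ : γ j = 0) :
    coeff (γ + Finsupp.single j (m - q)) (pointTransform q Finset.univ j b s) =
      coeff γ (PointBlowup.translate (Function.update b j 1) (homogeneousComponent m s.F)) := by
  have hsum : pointTransform q Finset.univ j b s = ∑ d ∈ s.F.support,
      PointBlowup.translate b (monomial (chartExponent q Finset.univ j d) (coeff d s.F)) := by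
    unfold pointTransform chartTransform PointBlowup.translate
    rw [map_sum]
  have hinit : PointBlowup.translate (Function.update b j 1) (homogeneousComponent m s.F) =
      ∑ d ∈ s.F.support with d.degree = m,
        PointBlowup.translate (Function.update b j 1) (monomial d (coeff d s.F)) := by
    rw [homogeneousComponent_apply]
    unfold PointBlowup.translate
    rw [map_sum]
  rw [hsum, hinit, coeff_sum, coeff_sum, Finset.sum_filter]
  refine Finset.sum_congr rfl fun d hd => ?_
  rw [WeightedBlowup.coeff_translate_monomial, WeightedBlowup.coeff_translate_monomial,
    ← Finset.mul_prod_erase Finset.univ _ (Finset.mem_univ j),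
    ← Finset.mul_prod_erase Finset.univ _ (Finset.mem_univ j)]
  have hrest : ∏ i ∈ Finset.univ.erase j,
      (((chartExponent q Finset.univ j d i).choose ((γ + Finsupp.single j (m - q)) i) : K) *
        b i ^ (chartExponent q Finset.univ j d i - (γ + Finsupp.single j (m - q)) i)) =
      ∏ i ∈ Finset.univ.erase j, (((d i).choose (γ i) : K) *
        Function.update b j 1 i ^ (d i - γ i)) := by
    refine Finset.prod_congr rfl fun i hi => ?_
    have hij : i ≠ j := Finset.ne_of_mem_erase hi
    rw [chartExponent_apply_of_ne q _ hij, Finsupp.add_apply, Finsupp.single_eq_of_ne hij, add_zero,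
      Function.update_of_ne hij]
  have hj1 : (((chartExponent q Finset.univ j d j).choose ((γ + Finsupp.single j (m - q)) j) : ℕ) : K) *
      b j ^ (chartExponent q Finset.univ j d j - (γ + Finsupp.single j (m - q)) j) =
      if d.degree = m then 1 else 0 := by
    rw [chartExponent_apply_self, degIn_univ, Finsupp.add_apply, hγ, zero_add,
      Finsupp.single_eq_same, hbj]
    by_cases hdeg : d.degree = m
    · rw [if_pos hdeg, hdeg, Nat.choose_self, Nat.sub_self, pow_zero, Nat.cast_one, one_mul]
    · rw [if_neg hdeg,
        zero_pow (Nat.sub_ne_zero_of_lt (by have := hm d hd; omega)), mul_zero]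
  have hj2 : (((d j).choose (γ j) : ℕ) : K) * Function.update b j 1 j ^ (d j - γ j) = 1 := by
    rw [hγ, Function.update_self, Nat.choose_zero_right, Nat.cast_one, one_pow, one_mul]
  rw [hrest, hj1, hj2, one_mul]
  split_ifs <;> simp

/-! ## §3 `q < ord₀ F < 2q`: a non-near point in every chart -/

omit [Fintype σ] [DecidableEq σ] in
/-- From `ord₀ F = m` to the support form, and non-vanishing of the degree-`m` component. OURS (bookkeeping).
[cite: Hauser2010, §C (order of X at a point)] -/
theorem homogeneousComponent_ne_zero_of_ordZero_eq {F : MvPolynomial σ K} {m : ℕ} (hord : ordZero F = m) :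
    (∀ d ∈ F.support, m ≤ d.degree) ∧ homogeneousComponent m F ≠ 0 := by
  obtain ⟨⟨d₀, hd₀, hd₀deg⟩, hmin⟩ := (ordZero_eq_nat_iff _ _).mp hord
  refine ⟨fun d hd => ?_, fun h0 => ?_⟩
  · by_contra hlt
    exact (mem_support_iff.mp hd) (hmin d (not_le.mp hlt))
  · have := congrArg (coeff d₀) h0
    rw [coeff_homogeneousComponent, if_pos hd₀deg, coeff_zero] at this
    exact hd₀ this

/-- **`q < ord₀ F < 2q` ⇒ a NON-equimultiple point in every chart** (infinite field; no cleanliness needed):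
if every `b` with `b_j = 0` were near, the `x_j^{m−q}`-coefficient `F_m(b̂)` (`0 < m − q < q`) would vanish
for all `b̂` with `b̂_j = 1`, forcing `F_m = 0`. OURS (elementary). [cite: Hauser2010, §F (equiconstant points)] -/
theorem exists_not_isEquimultiplePoint_of_lt_two_mul [Infinite K] {q m : ℕ} (hqm : q < m)
    (hm2 : m < 2 * q) (j : σ) (s : CState σ K) (hord : ordZero s.F = m) :
    ∃ b : σ → K, b j = 0 ∧ ¬ IsEquimultiplePoint q Finset.univ j b s := by
  obtain ⟨hsupp, hne⟩ := homogeneousComponent_ne_zero_of_ordZero_eq hord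
  by_contra hall
  push Not at hall
  apply hne
  refine eq_zero_of_isHomogeneous_of_forall_eval_update (homogeneousComponent_isHomogeneous m s.F) j
    fun b => ?_
  -- work at the point `b` with `b_j := 0`
  set b₀ : σ → K := Function.update b j 0 with hb₀
  have hb₀j : b₀ j = 0 := by rw [hb₀, Function.update_self]
  have hup : Function.update b₀ j 1 = Function.update b j 1 := by
    rw [hb₀, Function.update_idem]
  have hnear := hall b₀ hb₀j
  have hcoeff := hnear (Finsupp.single j (m - q)) (by
      rw [Ne, Finsupp.single_eq_zero]; omega) (by
      rw [Finsupp.degree_single]; omega)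
  have hlayer := coeff_add_single_pointTransform_univ hqm.le j b₀ hb₀j s hsupp 0
    (by rw [Finsupp.coe_zero, Pi.zero_apply])
  rw [zero_add] at hlayer
  rw [hlayer, coeff_zero_translate_eq_eval, hup] at hcoeff
  exact hcoeff

/-! ## §4 `ord₀ F = p`, `F` clean: a non-near point in every chart -/

omit [Fintype σ] in
/-- If `∂ᵢΦ = 0` then every monomial of `Φ` has `i`-exponent divisible by the characteristic `p`.
OURS (bookkeeping). [cite: Hauser2010, §I (p-th power monomials)] -/
theorem dvd_of_pderiv_eq_zero (p : ℕ) [CharP K p] {Φ : MvPolynomial σ K} {i : σ}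
    (h : pderiv i Φ = 0) {d : σ →₀ ℕ} (hd : d ∈ Φ.support) : p ∣ d i := by
  by_cases hdi : d i = 0
  · rw [hdi]; exact dvd_zero p
  obtain ⟨k, hk⟩ := Nat.exists_eq_succ_of_ne_zero hdi
  have hc := WeightedBlowup.coeff_pderiv_eq i Φ (d - Finsupp.single i 1)
  have hsub : d - Finsupp.single i 1 + Finsupp.single i 1 = d := by
    ext l
    rw [Finsupp.add_apply, Finsupp.tsub_apply, Finsupp.single_apply]
    split_ifs with hil
    · subst hil; omega
    · omega
  rw [h, coeff_zero, hsub, Finsupp.tsub_apply, Finsupp.single_eq_same] at hc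
  have hdi' : d i - 1 + 1 = d i := by omega
  rw [hdi'] at hc
  have hK : ((d i : ℕ) : K) = 0 := by
    rcases mul_eq_zero.mp hc.symm with h1 | h1
    · exact h1
    · exact absurd h1 (mem_support_iff.mp hd)
  exact (CharP.cast_eq_zero_iff K p (d i)).mp hK

/-- **`ord₀ F = p` and `F` clean ⇒ a NON-equimultiple point in every chart** (infinite field of
characteristic `p`): if every `b` (`b_j = 0`) were near, the linear coefficients `∂ᵢF_p(b̂)` (`i ≠ j`) of the
transform would vanish for all `b̂`, so `∂ᵢF_p = 0` for `i ≠ j`; then every monomial `x^d` of `F_p` has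
`p ∣ dᵢ` (`i ≠ j`) and, its degree being `p`, also `p ∣ d_j`: a `p`-th power monomial of `F` — which the
cleaning `deletePthPowers p F = F` excludes. OURS (elementary). [cite: Hauser2010, §G (cleaning) and §F] -/
theorem exists_not_isEquimultiplePoint_of_ordZero_eq [Infinite K] (p : ℕ) [hp : Fact p.Prime]
    [CharP K p] (j : σ) (s : CState σ K) (hord : ordZero s.F = p)
    (hclean : deletePthPowers p s.F = s.F) :
    ∃ b : σ → K, b j = 0 ∧ ¬ IsEquimultiplePoint p Finset.univ j b s := by
  obtain ⟨hsupp, hne⟩ := homogeneousComponent_ne_zero_of_ordZero_eq hord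
  by_contra hall
  push Not at hall
  -- (1) all partials off `j` of the initial form vanish
  have hpd : ∀ i, i ≠ j → pderiv i (homogeneousComponent p s.F) = 0 := by
    intro i hij
    have hhom : (pderiv i (homogeneousComponent p s.F)).IsHomogeneous (p - 1) :=
      (homogeneousComponent_isHomogeneous p s.F).pderiv
    refine eq_zero_of_isHomogeneous_of_forall_eval_update hhom j fun b => ?_
    set b₀ : σ → K := Function.update b j 0 with hb₀
    have hb₀j : b₀ j = 0 := by rw [hb₀, Function.update_self]
    have hup : Function.update b₀ j 1 = Function.update b j 1 := by rw [hb₀, Function.update_idem]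
    have hnear := hall b₀ hb₀j
    have hcoeff := hnear (Finsupp.single i 1) (by rw [Ne, Finsupp.single_eq_zero]; exact one_ne_zero)
      (by rw [Finsupp.degree_single]; exact hp.out.one_lt)
    have hlayer := coeff_add_single_pointTransform_univ le_rfl j b₀ hb₀j s hsupp (Finsupp.single i 1)
      (by rw [Finsupp.single_eq_of_ne hij.symm])
    rw [Nat.sub_self, Finsupp.single_zero, add_zero] at hlayer
    rw [hlayer, coeff_single_translate_eq_eval_pderiv, hup] at hcoeff
    exact hcoeff
  -- (2) a monomial of the initial form is a `p`-th power monomial of `F`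
  obtain ⟨⟨d₀, hd₀, hd₀deg⟩, -⟩ := (ordZero_eq_nat_iff _ _).mp hord
  have hd₀F : d₀ ∈ (homogeneousComponent p s.F).support := by
    rw [mem_support_iff, coeff_homogeneousComponent, if_pos hd₀deg]; exact hd₀
  have hdiv : ∀ i, p ∣ d₀ i := by
    have hoff : ∀ i, i ≠ j → p ∣ d₀ i := fun i hij => dvd_of_pderiv_eq_zero p (hpd i hij) hd₀F
    intro i
    by_cases hij : i = j
    · subst hij
      -- `d₀ i = p − Σ_{k ≠ i} d₀ k`, all other exponents divisible by `p`
      have hsum : d₀ i + ∑ k ∈ Finset.univ.erase i, d₀ k = p := by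
        rw [Finset.add_sum_erase _ _ (Finset.mem_univ i), ← Finsupp.degree_eq_sum, hd₀deg]
      have hrest : p ∣ ∑ k ∈ Finset.univ.erase i, d₀ k :=
        Finset.dvd_sum fun k hk => hoff k (Finset.ne_of_mem_erase hk)
      have : p ∣ d₀ i + ∑ k ∈ Finset.univ.erase i, d₀ k := by rw [hsum]
      exact (Nat.dvd_add_right hrest).mp (by rwa [add_comm] at this)
    · exact hoff i hij
  have hP : IsPthPowerExponent p d₀ := fun i _ => hdiv i
  have : coeff d₀ (deletePthPowers p s.F) = 0 := by rw [coeff_deletePthPowers, if_pos hP]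
  rw [hclean] at this
  exact hd₀ this

/-! ## §5 The LOCUS flag as an iff -/

/-- **Near everywhere in one chart forces `ord₀ F ≥ 2p`** (clean state of order `≥ p`, infinite field of
characteristic `p`). OURS (elementary). [cite: Hauser2010, §F (equiconstant points)] -/
theorem two_mul_le_ordZero_of_forall_isEquimultiplePoint [Infinite K] (p : ℕ) [Fact p.Prime] [CharP K p]
    (j : σ) (s : CState σ K) (hclean : deletePthPowers p s.F = s.F) (hp : (p : ℕ∞) ≤ ordZero s.F)
    (hall : ∀ b : σ → K, b j = 0 → IsEquimultiplePoint p Finset.univ j b s) :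
    ((2 * p : ℕ) : ℕ∞) ≤ ordZero s.F := by
  by_cases hF : s.F = 0
  · rw [hF, ordZero_zero]; exact le_top
  obtain ⟨m, hm⟩ := exists_ordZero_eq_natCast hF
  rw [hm] at hp ⊢
  have hpm : p ≤ m := by exact_mod_cast hp
  by_contra hlt
  have hm2 : m < 2 * p := by
    have := not_le.mp hlt
    exact_mod_cast this
  rcases hpm.eq_or_lt with h | h
  · have hordp : ordZero s.F = (p : ℕ∞) := by rw [hm, ← h]
    obtain ⟨b, hbj, hb⟩ := exists_not_isEquimultiplePoint_of_ordZero_eq p j s hordp hclean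
    exact hb (hall b hbj)
  · obtain ⟨b, hbj, hb⟩ := exists_not_isEquimultiplePoint_of_lt_two_mul h hm2 j s hm
    exact hb (hall b hbj)

/-- **`near_dim = n − 1 ⟺ ord₀ F ≥ 2p` (PR-3 ∧ PR-3c).** For a CLEAN state of order `≥ p` over an INFINITE
field of characteristic `p`, and any chart `x_j` of the point blow-up: every point of the exceptional
hyperplane `{x_j = 0}` is equimultiple iff `2p ≤ ord₀ F`. (⇐ is `isEquimultiplePoint_univ_of_two_mul_le_ordZero`
of `PurelyInseparableDim4NearDim`, over any field.) OURS (census: the LOCUS flag of the engines, read on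
geometric points, is exactly the small-order-gap condition). [cite: Hauser2010, §F (equiconstant points)] -/
theorem forall_isEquimultiplePoint_iff_two_mul_le_ordZero [Infinite K] (p : ℕ) [Fact p.Prime] [CharP K p]
    (j : σ) (s : CState σ K) (hclean : deletePthPowers p s.F = s.F) (hp : (p : ℕ∞) ≤ ordZero s.F) :
    (∀ b : σ → K, b j = 0 → IsEquimultiplePoint p Finset.univ j b s) ↔
      ((2 * p : ℕ) : ℕ∞) ≤ ordZero s.F :=
  ⟨two_mul_le_ordZero_of_forall_isEquimultiplePoint p j s hclean hp,
    fun h _ hbj => isEquimultiplePoint_univ_of_two_mul_le_ordZero j hbj h⟩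

end Summit.ResolutionOfSingularities.ResolutionOfSingularities.Theorems.PIDim4.NearDim

end
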